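import Mathlib

/-!
# Door D7 — multiplicative dissociativity of the polynomial digits (typed target)

Solo seat `solo-MatrixMultiplication-informed`, gen 10.  A *mixed system* consists of `p` pairs of
digits `(s k, d k)` and `q` singleton digits `t l`; its *polynomial digits* (generators) are
`X^(s k)`, `X^(s k) + X^(d k)` and `X^(t l)`.  The conjecture `MD` of the seat's sharpest statement
(§2h(12)–(13)) says that for a mixed DESIGN the `2^(2p+q)` subset products of the generators are
linearly independent over `ℚ`; Theorem A (`onePair_mixed_closure`) is the case `p = 1`.

This file types the products (`mixedProd`; MULTIPLICATIVE DISSOCIATIVITY = `LinearIndependent ℚ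
(mixedProd s d t)`) and proves the elementary half of the door:
linear independence of the subset products forces the digit sum to be at least `2^(2p+q) - 1`
(`two_pow_le_digitSum_succ_of_multDissociated`), because all products live in the space of
polynomials of degree `≤ Σ`, which has dimension `Σ + 1`.
-/

set_option linter.dupNamespace false

namespace Summit.MatrixMultiplication.MatrixMultiplication.Theorems

open Polynomial Finset

/-- Index type of the generators of a mixed system: `inl k` = the monomial `X^(s k)` of pair `k`,
`inr (inl k)` = the binomial `X^(s k) + X^(d k)` of pair `k`, `inr (inr l)` = the singleton `X^(t l)`. -/
abbrev MixedIdx (p q : ℕ) : Type := Fin p ⊕ (Fin p ⊕ Fin q)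

/-- The polynomial digits (generators) of the mixed system `(s, d; t)`. -/
noncomputable def mixedGen {p q : ℕ} (s d : Fin p → ℕ) (t : Fin q → ℕ) : MixedIdx p q → ℚ[X]
  | Sum.inl k => X ^ (s k)
  | Sum.inr (Sum.inl k) => X ^ (s k) + X ^ (d k)
  | Sum.inr (Sum.inr l) => X ^ (t l)

/-- Degree weight of a generator: `s k`, `max (s k) (d k)`, `t l`. -/
def mixedWeight {p q : ℕ} (s d : Fin p → ℕ) (t : Fin q → ℕ) : MixedIdx p q → ℕ
  | Sum.inl k => s k
  | Sum.inr (Sum.inl k) => max (s k) (d k)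
  | Sum.inr (Sum.inr l) => t l

/-- The subset product `∏_{i ∈ S} gen i` of the generators. -/
noncomputable def mixedProd {p q : ℕ} (s d : Fin p → ℕ) (t : Fin q → ℕ)
    (S : Finset (MixedIdx p q)) : ℚ[X] :=
  ∏ i ∈ S, mixedGen s d t i

/-- Each generator has degree at most its weight. -/
theorem natDegree_mixedGen_le {p q : ℕ} (s d : Fin p → ℕ) (t : Fin q → ℕ) (i : MixedIdx p q) :
    (mixedGen s d t i).natDegree ≤ mixedWeight s d t i := by
  rcases i with k | k | l
  · simp [mixedGen, mixedWeight]
  · simp only [mixedGen, mixedWeight]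
    refine (natDegree_add_le _ _).trans ?_
    simp
  · simp [mixedGen, mixedWeight]

/-- Every subset product has degree at most the total weight `∑ i, mixedWeight i`. -/
theorem natDegree_mixedProd_le {p q : ℕ} (s d : Fin p → ℕ) (t : Fin q → ℕ)
    (S : Finset (MixedIdx p q)) :
    (mixedProd s d t S).natDegree ≤ ∑ i, mixedWeight s d t i := by
  unfold mixedProd
  refine (natDegree_prod_le _ _).trans ?_
  calc ∑ i ∈ S, (mixedGen s d t i).natDegree ≤ ∑ i ∈ S, mixedWeight s d t i :=
        sum_le_sum fun i _ => natDegree_mixedGen_le s d t i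
    _ ≤ ∑ i, mixedWeight s d t i :=
        sum_le_sum_of_subset_of_nonneg (subset_univ S) fun _ _ _ => Nat.zero_le _

/-- The total weight is at most the digit sum `∑ (s k + d k) + ∑ t l` (pairs have `s k ≤ d k`). -/
theorem sum_mixedWeight_le {p q : ℕ} (s d : Fin p → ℕ) (t : Fin q → ℕ)
    (hsd : ∀ k, s k ≤ d k) :
    ∑ i, mixedWeight s d t i ≤ ∑ k, (s k + d k) + ∑ l, t l := by
  rw [Fintype.sum_sum_type, Fintype.sum_sum_type]
  simp only [mixedWeight]
  have h1 : ∑ k, s k + ∑ k, max (s k) (d k) ≤ ∑ k, (s k + d k) := by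
    rw [← sum_add_distrib]
    exact sum_le_sum fun k _ => by rw [max_eq_right (hsd k)]
  omega

/-- THE ELEMENTARY HALF OF DOOR D7: if the subset products of the polynomial digits are linearly
independent (and `s k ≤ d k`), then `2^(2p+q) ≤ digit sum + 1` — they are `2^(2p+q)` independent
vectors in the `(Σ+1)`-dimensional space `ℚ[X]_{≤ Σ}`. -/
theorem two_pow_le_digitSum_succ_of_multDissociated {p q : ℕ} (s d : Fin p → ℕ) (t : Fin q → ℕ)
    (hsd : ∀ k, s k ≤ d k) (h : LinearIndependent ℚ (mixedProd s d t)) :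
    2 ^ (2 * p + q) ≤ (∑ k, (s k + d k) + ∑ l, t l) + 1 := by
  classical
  set W : ℕ := ∑ i, mixedWeight s d t i with hW
  -- every product lies in `degreeLT ℚ (W+1)`
  have hmem : ∀ S : Finset (MixedIdx p q), mixedProd s d t S ∈ degreeLT ℚ (W + 1) := by
    intro S
    rw [mem_degreeLT]
    refine lt_of_le_of_lt (degree_le_natDegree) ?_
    exact_mod_cast Nat.lt_succ_of_le (natDegree_mixedProd_le s d t S)
  -- corestrict the family
  let g : Finset (MixedIdx p q) → degreeLT ℚ (W + 1) := fun S => ⟨mixedProd s d t S, hmem S⟩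
  have hcomp : (degreeLT ℚ (W + 1)).subtype ∘ g = mixedProd s d t := by
    funext S; rfl
  have hg : LinearIndependent ℚ g := by
    refine LinearIndependent.of_comp (degreeLT ℚ (W + 1)).subtype ?_
    rw [hcomp]; exact h
  have hcard := hg.fintype_card_le_finrank
  have hfin : Module.finrank ℚ ↥(degreeLT ℚ (W + 1)) = W + 1 := by
    rw [LinearEquiv.finrank_eq (degreeLTEquiv ℚ (W + 1)), Module.finrank_fin_fun]
  rw [hfin] at hcard
  simp only [Fintype.card_finset, Fintype.card_sum, Fintype.card_fin] at hcard
  have hexp : p + (p + q) = 2 * p + q := by ring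
  rw [hexp] at hcard
  have := sum_mixedWeight_le s d t hsd
  omega

end Summit.MatrixMultiplication.MatrixMultiplication.Theorems
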